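import Summits.BirchSwinnertonDyer.Rank1Residual.Iwasawa.KerGZeroCardDvdProd
import Summits.BirchSwinnertonDyer.Rank1Residual.Iwasawa.LocalTowerKernelCardLeTamagawa
import Literature.NumberTheory.EllipticCurves.TamagawaSubgroupProofs
import Literature.NumberTheory.EllipticCurves.TamagawaFiniteIndexProofs
import HarnessLib

/-!
# Tamagawa-tolerant control over ANY number field: the duality-free Euler-characteristic
# divisibility `f(0) ∣ #Sel_{p^∞}(E/K) · p ^ Σ_{v ∈ S} ord_p c_v` with sockets ONLY above `p`
# (team n1011, row T-CTL-TAM, seat p06 GEN 10, FILE 8 — K-general packaging of FILES 1 + 6)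

HONEST FRAMING (cell `b2b-bsdres-*`, team n1011, verbatim): prove what is provable now; shrink each
hard class to its core with data; no claim beyond stated classes. Research route; TOOL theorems
only — no definition, no named fact, nothing booked, no residual-map mark moved, no class closed.

## What

Row T-CTL-EC (`Iwasawa/SelmerCardOfLevelZeroControl`) read the tree's Thm-4.1 skeleton as
`f(0) ∣ #Sel_{p^∞}(E/K)` behind TRIVIAL level-`0` local tower kernels at EVERY place. FILE 1 of this
row kept `ker g_0` and bounded it by `∏_{v ∈ S} #𝒦_{v,0}[p^∞]`; FILE 6 (T-CTL-TAM♯) proved Greenberg's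
sharp count `#𝒦_{v,0}[p^∞] ≤ p ^ ord_p c_v` at every `v ∤ p` (any `ℤ_p`-extension, any reduction). This
file packages the two for an ARBITRARY NUMBER FIELD `K` (the currency of the base-change-and-descend
programme for X3/X4): for `E = W` elliptic over `K`, ANY `ℤ_p`-extension `κ` with topological
generator `γ`, any dual datum `D`, any generator `f` of `char_Λ X(E/K_∞)`, a finite set `S` of places
off which every place is prime to `p` and good, and the sockets ABOVE `p` only
(`𝒦_{v,0}[p^∞] = ⊥` at `v ∈ S`, `v ∣ p` — good ordinary non-anomalous: T-GR34NA; additive potentially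
good ordinary: T-T3B F7; potentially multiplicative: T-T3M), with `E(K)[p] = 0` and `Sel_{p^∞}(E/K)`
finite:

* `localTowerKerPrimary_zero_eq_bot_of_not_dvd_localTamagawaNumber` — the SHARP vanishing socket
  `p ∤ c_v ⟹ 𝒦_{v,0}[p^∞] = ⊥` at `v ∤ p` (Greenberg's Prop. 3.8 Remark (ii)/(iii) verbatim; supersedes
  the numeric test `p ∤ c_ℓ · N_ℓ` of T-T3CTL F2c) and
  `subsingleton_X_of_card_selmer_eq_one_of_not_dvd_localTamagawaNumber` (Prop. 3.8: `X(E/K_∞) = 0`);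
* `prod_natCard_localTowerKerPrimary_dvd_pow_sum` — `∏_{v∈S} #𝒦_{v,0}[p^∞] ∣ p ^ Σ_{v∈S} ord_p c_v`;
* **`constantCoeff_dvd_natCard_selmer_mul_pow_sum_of_no_pTorsion`** —
  `f(0) ∣ #Sel_{p^∞}(E/K) · p ^ Σ_{v ∈ S} ord_p c_v` in `ℤ_p`, i.e.
  `ord_p f(0) ≤ ord_p #Sel_{p^∞}(E/K) + Σ_{v ∈ S} ord_p c_v` — the TAMAGAWA-TOLERANT duality-free
  Euler-characteristic inequality (no Poitou–Tate, no Lemma 4.4/4.7, no hypothesis at the bad places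
  away from `p`);
* `tamagawaProduct_eq_prod_of_good` (K-general: `Tam(E/K) = ∏_{v∈S} c_v`) and
  `constantCoeff_dvd_natCard_selmer_mul_pow_padicValNat_tamagawaProduct_of_no_pTorsion` —
  **`f(0) ∣ #Sel_{p^∞}(E/K) · p ^ ord_p Tam(E/K)`**, i.e. `ord_p f(0) ≤ ord_p #Sel_{p^∞}(E/K) + ord_p Tam(E/K)`
  (each `c_v ≠ 0` by the tree's `localTamagawaNumber_baseChange_ne_zero`, any number field).

Greenberg's Thm. 4.1 (LNM 1716, p. 102) has `f(0) ∼ #Ш · ∏ c_v^{(p)} · (terms at p) / #E(K)_p²`; the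
inequality here is its LOWER-half shadow, available without the duality inputs. Axioms standard.

References: [GreenbergLNM1716] §3 Lemma 3.3 (p. 87), Lemma 3.5 (p. 90), §4 Thm. 4.1 and Lemmas
4.2–4.3 (pp. 102–104), p. 74; [SilvermanAEC2009] VII.2 (remark after Prop. 2.1), Cor. VII.6.2.
-/

noncomputable section

open scoped Classical

universe u

namespace Summit.BirchSwinnertonDyer.Rank1Residual.Iwasawa

open Literature.NumberTheory.EllipticCurves Literature.NumberTheory.EllipticCurves.IwasawaDual
  Literature.NumberTheory.GaloisRepresentations NumberField IsDedekindDomain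

/-! ## §0. Greenberg's Prop. 3.8 (ii)/(iii) verbatim: `p ∤ c_v ⟹ 𝒦_{v,0}[p^∞] = ⊥` -/

section Vanishing

variable {K : Type u} [Field K] [NumberField K] (W : WeierstrassCurve K) {p : ℕ} [hp : Fact p.Prime]
  (κ : ZpExtension K p)

/-- **The SHARP vanishing socket: `p ∤ c_v ⟹ 𝒦_{v,0}[p^∞] = ⊥` at every `v ∤ p`, for ANY
`ℤ_p`-extension and ANY reduction type** — Greenberg's restatement of hypotheses (ii)/(iii) of
Prop. 3.8 (LNM 1716, Remark p. 95: "(ii) and (iii) … `p ∤ c_l` for all `l ≠ p`"), now a theorem of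
the tree in the Literature/n1011 currency (FILE 6's count `#𝒦_{v,0}[p^∞] ≤ p ^ ord_p c_v` with
`ord_p c_v = 0`). Supersedes the numeric test `p ∤ c_ℓ · N_ℓ` of row T-T3CTL F2c
(`Iwasawa/LocalTowerKernelNumericTest`) wherever that socket is consumed.
[cite: GreenbergLNM1716, §3 Prop. 3.8 and Remark (pp. 95–96), Lemma 3.3 (p. 87)] -/
theorem localTowerKerPrimary_zero_eq_bot_of_not_dvd_localTamagawaNumber [W.IsElliptic]
    {v : HeightOneSpectrum (𝓞 K)} (hpv : (p : 𝓞 K) ∉ v.asIdeal)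
    (hc : ¬ p ∣ (W.baseChange (v.adicCompletion K)).localTamagawaNumber (v.adicCompletionIntegers K)) :
    W.localTowerKerPrimary κ (v.adicCompletion K) 0 = ⊥ := by
  haveI := W.finite_localTowerKerPrimary_zero_of_not_mem κ hpv
  have h := natCard_localTowerKerPrimary_zero_le_pow_padicValNat_localTamagawaNumber W κ hpv
  rw [padicValNat.eq_zero_of_not_dvd hc, pow_zero] at h
  exact (W.localTowerKerPrimary κ (v.adicCompletion K) 0).eq_bot_of_card_le h

/-- **Greenberg's Prop. 3.8 with the SHARP sockets away from `p` (finite-set form, any number field,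
any `ℤ_p`-extension): `#Sel_{p^∞}(E/K) = 1`, `p ∤ c_v` at the places `v ∈ S` away from `p`, and
trivial kernels above `p` ⟹ `X(E/K_∞) = 0`** — row T-T3CTL F1's
`subsingleton_X_of_card_selmer_eq_one_of_finset` fed with the sharp socket.
[cite: GreenbergLNM1716, §3 Prop. 3.8 and Remark (pp. 95–96)] -/
theorem subsingleton_X_of_card_selmer_eq_one_of_not_dvd_localTamagawaNumber [W.IsElliptic]
    {γ : Field.absoluteGaloisGroup K} (D : W.SelmerDualData κ γ) (hγ : κ.IsTopGenerator γ)
    (hSel : Nat.card (W.selmerGroupPInfty p) = 1) (S : Finset (HeightOneSpectrum (𝓞 K)))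
    (hS : ∀ v ∈ S, (p : 𝓞 K) ∉ v.asIdeal →
      ¬ p ∣ (W.baseChange (v.adicCompletion K)).localTamagawaNumber (v.adicCompletionIntegers K))
    (hSp : ∀ v ∈ S, (p : 𝓞 K) ∈ v.asIdeal → W.localTowerKerPrimary κ (v.adicCompletion K) 0 = ⊥)
    (hgood : ∀ v ∉ S, (p : 𝓞 K) ∉ v.asIdeal ∧ W.HasGoodReductionAt v) :
    Subsingleton D.X := by
  refine subsingleton_X_of_card_selmer_eq_one_of_finset D hγ hSel S (fun v hv ↦ ?_) hgood
  by_cases hpv : (p : 𝓞 K) ∈ v.asIdeal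
  · exact hSp v hv hpv
  · exact localTowerKerPrimary_zero_eq_bot_of_not_dvd_localTamagawaNumber W κ hpv (hS v hv hpv)

end Vanishing

/-! ## §1. The product of the local counts -/

section Local

variable {K : Type u} [Field K] [NumberField K] (W : WeierstrassCurve K) {p : ℕ} [hp : Fact p.Prime]
  (κ : ZpExtension K p)

/-- **`∏_{v ∈ S} #𝒦_{v,0}[p^∞] ∣ p ^ Σ_{v ∈ S} ord_p c_v`** when the kernels ABOVE `p` in `S` are
trivial: at `v ∤ p` the `p`-group `𝒦_{v,0}[p^∞]` has order `p^{a_v}` with `a_v ≤ ord_p c_v` (FILE 6,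
Greenberg's Lemma 3.3 sharp); above `p` the factor is `1`.
[cite: GreenbergLNM1716, §3 Lemma 3.3 (proof, pp. 86–88) and §4 proof of Thm. 4.1 (p. 74)] -/
theorem prod_natCard_localTowerKerPrimary_dvd_pow_sum [W.IsElliptic]
    (S : Finset (HeightOneSpectrum (𝓞 K)))
    (hSp : ∀ v ∈ S, (p : 𝓞 K) ∈ v.asIdeal → W.localTowerKerPrimary κ (v.adicCompletion K) 0 = ⊥) :
    (∀ v ∈ S, Finite (W.localTowerKerPrimary κ (v.adicCompletion K) 0)) ∧
      ∏ v ∈ S, Nat.card (W.localTowerKerPrimary κ (v.adicCompletion K) 0) ∣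
        p ^ ∑ v ∈ S, padicValNat p ((W.baseChange (v.adicCompletion K)).localTamagawaNumber
          (v.adicCompletionIntegers K)) := by
  have hfin : ∀ v ∈ S, Finite (W.localTowerKerPrimary κ (v.adicCompletion K) 0) := by
    intro v hv
    by_cases hpv : (p : 𝓞 K) ∈ v.asIdeal
    · rw [hSp v hv hpv]; infer_instance
    · exact W.finite_localTowerKerPrimary_zero_of_not_mem κ hpv
  refine ⟨hfin, ?_⟩
  rw [← Finset.prod_pow_eq_pow_sum]
  refine Finset.prod_dvd_prod_of_dvd _ _ fun v hv ↦ ?_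
  by_cases hpv : (p : 𝓞 K) ∈ v.asIdeal
  · rw [hSp v hv hpv, AddSubgroup.card_bot]
    exact one_dvd _
  · haveI := hfin v hv
    rw [natCard_localTowerKerPrimary_eq_pow_padicValNat W κ (v.adicCompletion K) 0]
    refine pow_dvd_pow p ((Nat.pow_le_pow_iff_right hp.out.one_lt).mp ?_)
    rw [← natCard_localTowerKerPrimary_eq_pow_padicValNat W κ (v.adicCompletion K) 0]
    exact natCard_localTowerKerPrimary_zero_le_pow_padicValNat_localTamagawaNumber W κ hpv

omit hp κ in
/-- **`Tam(E/K) = ∏_{v ∈ S} c_v`** when every place off `S` has good reduction (`c_v = 1` there, tree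
`localTamagawaNumber_eq_one_of_hasGoodReductionAt_holds`; any number field).
[cite: SilvermanAEC2009, VII.2 (remark after Prop. 2.1)] -/
theorem tamagawaProduct_eq_prod_of_good (S : Finset (HeightOneSpectrum (𝓞 K)))
    (hgood : ∀ v ∉ S, W.HasGoodReductionAt v) :
    W.tamagawaProduct = ∏ v ∈ S,
      (W.baseChange (v.adicCompletion K)).localTamagawaNumber (v.adicCompletionIntegers K) := by
  unfold WeierstrassCurve.tamagawaProduct
  refine finprod_eq_prod_of_mulSupport_subset _ fun v hv ↦ ?_
  rw [Finset.mem_coe]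
  by_contra hvS
  exact hv (W.localTamagawaNumber_eq_one_of_hasGoodReductionAt_holds v (hgood v hvS))

omit κ in
/-- `ord_p` of a finite product of non-zero naturals is the sum of the `ord_p`. [folklore] -/
private theorem padicValNat_finset_prod {ι : Type*} (s : Finset ι) (f : ι → ℕ)
    (hf : ∀ i ∈ s, f i ≠ 0) : padicValNat p (∏ i ∈ s, f i) = ∑ i ∈ s, padicValNat p (f i) := by
  induction s using Finset.cons_induction with
  | empty => simp
  | cons a s ha ih =>
    rw [Finset.prod_cons, Finset.sum_cons,
      padicValNat.mul (hf a (Finset.mem_cons_self a s))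
        (Finset.prod_ne_zero_iff.mpr fun i hi ↦ hf i (Finset.mem_cons_of_mem hi)),
      ih fun i hi ↦ hf i (Finset.mem_cons_of_mem hi)]

omit κ in
/-- `Σ_{v ∈ S} ord_p c_v = ord_p Tam(E/K)` when `S` contains every bad place (each `c_v` is a finite
index, `≠ 0`: tree `localTamagawaNumber_baseChange_ne_zero`, Silverman Cor. VII.6.2).
[cite: SilvermanAEC2009, Cor. VII.6.2] -/
theorem sum_padicValNat_localTamagawaNumber_eq [W.IsElliptic] (S : Finset (HeightOneSpectrum (𝓞 K)))
    (hgood : ∀ v ∉ S, W.HasGoodReductionAt v) :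
    ∑ v ∈ S, padicValNat p ((W.baseChange (v.adicCompletion K)).localTamagawaNumber
        (v.adicCompletionIntegers K)) = padicValNat p W.tamagawaProduct := by
  rw [tamagawaProduct_eq_prod_of_good W S hgood,
    padicValNat_finset_prod S _ fun v _ ↦ W.localTamagawaNumber_baseChange_ne_zero v]

end Local

/-! ## §2. The Tamagawa-tolerant Euler-characteristic divisibility over any number field -/

section Euler

variable {K : Type u} [Field K] [NumberField K] (W : WeierstrassCurve K) [W.IsElliptic]
  {p : ℕ} [hp : Fact p.Prime] {κ : ZpExtension K p} {γ : Field.absoluteGaloisGroup K}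

/-- **`f(0) ∣ #Sel_{p^∞}(E/K) · p ^ Σ_{v ∈ S} ord_p c_v` in `ℤ_p` — the Tamagawa-tolerant duality-free
Euler-characteristic inequality over ANY number field.** For `E/K` elliptic, ANY `ℤ_p`-extension `κ`
with topological generator `γ`, any dual datum `D`, any generator `f` of `char_Λ X(E/K_∞)`: if
`Sel_{p^∞}(E/K)` is finite, `E(K)[p] = 0`, every place off the finite set `S` is prime to `p` and
good, and the level-`0` local tower kernels ABOVE `p` in `S` have trivial `p`-power torsion, then
`ord_p f(0) ≤ ord_p #Sel_{p^∞}(E/K) + Σ_{v ∈ S} ord_p c_v` (FILE 1's counted skeleton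
`f(0) ∣ #Sel · ∏ #𝒦_{v,0}[p^∞]` and FILE 6's sharp local counts). NO hypothesis at the bad places away
from `p`; no Poitou–Tate / Lemma 4.7; Greenberg's Thm. 4.1 lower-half shadow.
[cite: GreenbergLNM1716, §4 Thm. 4.1 (proof, pp. 102–104), §3 Lemma 3.5 (p. 90), Lemma 3.3 (p. 87), p. 74] -/
theorem constantCoeff_dvd_natCard_selmer_mul_pow_sum_of_no_pTorsion
    (D : W.SelmerDualData κ γ) (hγ : κ.IsTopGenerator γ) (hSel : Finite ↥(W.selmerGroupPInfty p))
    (hK : ∀ P : W.toAffine.Point, p • P = 0 → P = 0)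
    (f : IwasawaAlgebra p) (hf : D.charIdeal = Ideal.span {f})
    (S : Finset (HeightOneSpectrum (𝓞 K)))
    (hSp : ∀ v ∈ S, (p : 𝓞 K) ∈ v.asIdeal → W.localTowerKerPrimary κ (v.adicCompletion K) 0 = ⊥)
    (hgood : ∀ v ∉ S, (p : 𝓞 K) ∉ v.asIdeal ∧ W.HasGoodReductionAt v) :
    PowerSeries.constantCoeff f ∣
      ((Nat.card ↥(W.selmerGroupPInfty p) *
        p ^ ∑ v ∈ S, padicValNat p ((W.baseChange (v.adicCompletion K)).localTamagawaNumber
          (v.adicCompletionIntegers K)) : ℕ) : ℤ_[p]) := by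
  obtain ⟨hfin, hdvd⟩ := prod_natCard_localTowerKerPrimary_dvd_pow_sum W κ S hSp
  exact (constantCoeff_dvd_natCard_selmer_mul_prod_of_no_pTorsion_of_good W D hγ hSel hK f hf S hfin
    hgood).trans (Nat.cast_dvd_cast (mul_dvd_mul_left _ hdvd))

/-- **`f(0) ∣ #Sel_{p^∞}(E/K) · p ^ ord_p Tam(E/K)` — `ord_p f(0) ≤ ord_p #Sel_{p^∞}(E/K) + ord_p Tam(E/K)`
over ANY number field**, sockets only above `p` (`Tam = ∏_{v∈S} c_v` off the good places, every `c_v`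
a finite index). [cite: GreenbergLNM1716, §4 Thm. 4.1 (proof, pp. 102–104), §3 Lemma 3.5 (p. 90), Lemma 3.3 (p. 87), p. 74] -/
theorem constantCoeff_dvd_natCard_selmer_mul_pow_padicValNat_tamagawaProduct_of_no_pTorsion
    (D : W.SelmerDualData κ γ) (hγ : κ.IsTopGenerator γ) (hSel : Finite ↥(W.selmerGroupPInfty p))
    (hK : ∀ P : W.toAffine.Point, p • P = 0 → P = 0)
    (f : IwasawaAlgebra p) (hf : D.charIdeal = Ideal.span {f})
    (S : Finset (HeightOneSpectrum (𝓞 K)))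
    (hSp : ∀ v ∈ S, (p : 𝓞 K) ∈ v.asIdeal → W.localTowerKerPrimary κ (v.adicCompletion K) 0 = ⊥)
    (hgood : ∀ v ∉ S, (p : 𝓞 K) ∉ v.asIdeal ∧ W.HasGoodReductionAt v) :
    PowerSeries.constantCoeff f ∣
      ((Nat.card ↥(W.selmerGroupPInfty p) * p ^ padicValNat p W.tamagawaProduct : ℕ) : ℤ_[p]) := by
  rw [← sum_padicValNat_localTamagawaNumber_eq W S (fun v hv ↦ (hgood v hv).2)]
  exact constantCoeff_dvd_natCard_selmer_mul_pow_sum_of_no_pTorsion W D hγ hSel hK f hf S hSp hgood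

end Euler

end Summit.BirchSwinnertonDyer.Rank1Residual.Iwasawa

end
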